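import Summits.PneNP.PneNP.Theses.DirichletPigeons

/-!
# Route DirichletPigeons — `SimultaneousDirichlet` (stmt-PneNP-3083)

Dirichlet's simultaneous approximation theorem in the form used by crux C2: for `d`, `a ∈ ℤ^d`, `b` and `Q ≥ 1` there is
`1 ≤ q ≤ Q^d` with `|q aᵢ/b − round(q aᵢ/b)| < 1/Q` for every `i`. Pigeonhole: the `Q^d + 1` fractional-part vectors
`({q aᵢ/b})ᵢ`, `0 ≤ q ≤ Q^d`, fall into `Q^d` boxes of side `1/Q` (`Fintype.exists_ne_map_eq_of_card_lt`); two in one box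
differ by the wanted `q` (`Int.abs_sub_lt_one_of_floor_eq_floor`, `round_le`).
-/

set_option linter.dupNamespace false -- `Summit.PneNP.PneNP.…`: summit = sub-problem name (D-0017 single-conjunct layout)

namespace Summit.PneNP.PneNP.Theorems

/-- **Support item `SimultaneousDirichlet` of route DirichletPigeons (stmt-PneNP-3083)**: simultaneous Diophantine approximation
`∃ 1 ≤ q ≤ Q^d, ∀ i, ‖q aᵢ/b‖ < 1/Q` by the pigeonhole principle on `Q^d` boxes. [cite: Lagarias1985, §1] [folklore] -/
theorem dirichletPigeons_simultaneousDirichlet_proof : Summit.PneNP.PneNP.Theses.DirichletPigeons.SimultaneousDirichlet := by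
  unfold Summit.PneNP.PneNP.Theses.DirichletPigeons.SimultaneousDirichlet
  intro dn d a b Q hQ
  have hQpos : (0 : ℚ) < Q := by exact_mod_cast hQ
  -- the points and their boxes
  let x : ℕ → Fin d → ℚ := fun q i => (q : ℚ) * a i / b
  have hbox : ∀ (q : ℕ) (i : Fin d), 0 ≤ ⌊(Q : ℚ) * Int.fract (x q i)⌋ ∧ (⌊(Q : ℚ) * Int.fract (x q i)⌋).toNat < Q := by
    intro q i
    have h0 : 0 ≤ (Q : ℚ) * Int.fract (x q i) := mul_nonneg hQpos.le (Int.fract_nonneg _)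
    have h1 : (Q : ℚ) * Int.fract (x q i) < Q := by
      have := Int.fract_lt_one (x q i)
      nlinarith
    refine ⟨Int.floor_nonneg.2 h0, ?_⟩
    have hlt : ⌊(Q : ℚ) * Int.fract (x q i)⌋ < Q := Int.floor_lt.2 (by exact_mod_cast h1)
    omega
  let F : Fin (Q ^ d + 1) → (Fin d → Fin Q) := fun q i => ⟨(⌊(Q : ℚ) * Int.fract (x q i)⌋).toNat, (hbox q i).2⟩
  have hcard : Fintype.card (Fin d → Fin Q) < Fintype.card (Fin (Q ^ d + 1)) := by
    simp [Fintype.card_fin]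
  obtain ⟨q₁, q₂, hne, heq⟩ := Fintype.exists_ne_map_eq_of_card_lt F hcard
  -- order the two colliding indices
  wlog hlt : (q₁ : ℕ) < q₂ generalizing q₁ q₂
  · exact this q₂ q₁ hne.symm heq.symm (lt_of_le_of_ne (not_lt.1 hlt) fun h => hne (Fin.ext h).symm)
  refine ⟨(q₂ : ℕ) - q₁, by omega, by have := q₂.isLt; omega, fun i => ?_⟩
  -- same box: fractional parts are `1/Q`-close
  have hfl : ⌊(Q : ℚ) * Int.fract (x q₁ i)⌋ = ⌊(Q : ℚ) * Int.fract (x q₂ i)⌋ := by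
    have h := congrArg (fun f : Fin d → Fin Q => ((f i : Fin Q) : ℕ)) heq
    simp only [F] at h
    have e1 := Int.toNat_of_nonneg (hbox q₁ i).1
    have e2 := Int.toNat_of_nonneg (hbox q₂ i).1
    rw [← e1, ← e2]
    exact_mod_cast h
  have hclose : |Int.fract (x q₂ i) - Int.fract (x q₁ i)| < 1 / (Q : ℚ) := by
    have h := Int.abs_sub_lt_one_of_floor_eq_floor hfl.symm
    rw [← mul_sub, abs_mul, abs_of_pos hQpos] at h
    rw [lt_div_iff₀ hQpos, mul_comm]
    exact h
  -- the difference is the wanted point, up to an integer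
  have hdiff : (((q₂ : ℕ) - q₁ : ℕ) : ℚ) * a i / b = x q₂ i - x q₁ i := by
    simp only [x]
    rw [Nat.cast_sub hlt.le]
    ring
  show |(((q₂ : ℕ) - q₁ : ℕ) : ℚ) * a i / b - ((round ((((q₂ : ℕ) - q₁ : ℕ) : ℚ) * a i / b) : ℤ) : ℚ)| < 1 / (Q : ℚ)
  rw [hdiff]
  refine lt_of_le_of_lt (round_le (x q₂ i - x q₁ i) (⌊x q₂ i⌋ - ⌊x q₁ i⌋)) ?_
  have hrw : x q₂ i - x q₁ i - ((⌊x q₂ i⌋ - ⌊x q₁ i⌋ : ℤ) : ℚ) = Int.fract (x q₂ i) - Int.fract (x q₁ i) := by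
    simp only [Int.fract, Int.cast_sub]
    ring
  rw [hrw]
  exact hclose

end Summit.PneNP.PneNP.Theorems
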